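import Summits.MatrixMultiplication.MatrixMultiplication.Theorems.SoloInformedTwistedTPPStability
import HarnessLib

/-!
# Few-multiplier TPP stability, V: translation schemes and cyclotomic schemes (CU13 Def. 12, literally)

Solo-informed seat (MatrixMultiplication), gen 104; dossier `paper/theoremB2.md` §7 (Theorem C2 and
Corollary C′, scheme-level statements).

`translationScheme_fpf_realization_cube_le`: let `S` be a finite abelian group and `M₀ ≤ Aut S` an
ABELIAN subgroup acting FIXED-POINT-FREELY (`φ g = g, φ ≠ 1 ⟹ g = 1`); if the translation scheme
`𝒮(S, M₀)` (Cohn–Umans 2013 §5: classes = `M₀`-orbits of `y x⁻¹`, labelled by `c`) realizes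
`⟨n,n,n⟩` in the sense of CU13 Def. 12 ("`A x, B y, Γ z` form a triangle iff `(x,y,z)` is a
matrix-multiplication triple"), then `n³ ≤ 115200·|M₀|¹⁰·|S|`, and with rank `≥ |S|/|M₀|`
(`card_le_card_labels_mul`): `n³ ≤ 115200·|M₀|¹¹·#labels`. So Conj. 21 (rank `n^{2+o(1)}`) along
such schemes forces `|M₀| ≥ n^{(1-o(1))/11}` — few multipliers never suffice.
`cyclotomicScheme_realization_cube_le`: the same for the cyclotomic schemes `Cyc(q, H)` (`S = 𝔽_q`,
`M₀ = H ≤ 𝔽_qˣ`, automatically abelian and fixed-point-free): `n³ ≤ 115200·|H|¹⁰·q`. Together with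
`Cyclotomic.cyclotomicScheme_realization_bound` (few classes never suffice) this refutes Conj. 21 on
the whole cyclotomic family (dossier §7, Cor. C′: rank `≥ c·n^{69/34}` in kernel constants).
References: CohnUmans2013 (arXiv:1207.6528) Def. 11, Def. 12, §5, Conj. 21; this work.
-/

noncomputable section

open scoped BigOperators
open Finset

namespace Summit.MatrixMultiplication.MatrixMultiplication.Theorems.TwistedTPP

open Summit.MatrixMultiplication.MatrixMultiplication.Theorems.TwistedSliceRank in
/-- **Theorem C2 for translation schemes (CU13 Def. 12, literally).** `S` finite abelian, `M₀ ≤ Aut S`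
abelian and fixed-point-free, `c` an `M₀`-orbit labelling, `A, B, Γ : [n]² → C` with "triangle iff
matrix-multiplication triple": then `n³ ≤ 115200·|M₀|¹⁰·|S|`. [this work, Thm C2] -/
theorem translationScheme_fpf_realization_cube_le (S : Type*) [CommGroup S] [Fintype S]
    (M₀ : Subgroup (MulAut S)) (hcomm : ∀ φ ψ : M₀, φ * ψ = ψ * φ)
    (hfpf : ∀ φ : M₀, φ ≠ 1 → ∀ g : S, (φ : MulAut S) g = g → g = 1)
    {C : Type*} (c : S → C) (hc : ∀ g h : S, c g = c h ↔ ∃ φ : M₀, (φ : MulAut S) g = h)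
    {n : ℕ} (Acl Bcl Γ : Fin n × Fin n → C)
    (hreal : ∀ x y z : Fin n × Fin n,
      (∃ g h l : S, c g = Acl x ∧ c h = Bcl y ∧ c l = Γ z ∧ g * h * l = 1) ↔
        (y.1 = x.2 ∧ z = (y.2, x.1))) :
    n ^ 3 ≤ 115200 * Nat.card M₀ ^ 10 * Fintype.card S := by
  classical
  rcases Nat.eq_zero_or_pos n with rfl | hn
  · simp
  haveI : Finite (MulAut S) :=
    Finite.of_injective (fun e : MulAut S => (e : S → S)) DFunLike.coe_injective
  haveI : Fintype M₀ := Fintype.ofFinite _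
  letI : CommGroup M₀ := { (inferInstance : Group M₀) with mul_comm := hcomm }
  -- orbit representatives of the classes used
  have w : Fin n := ⟨0, hn⟩
  have hA : ∀ x, ∃ g : S, c g = Acl x := fun x => by
    obtain ⟨g, h, l, hg, -, -, -⟩ := (hreal x (x.2, w) (w, x.1)).2 ⟨rfl, rfl⟩
    exact ⟨g, hg⟩
  have hB : ∀ y, ∃ g : S, c g = Bcl y := fun y => by
    obtain ⟨g, h, l, -, hh, -, -⟩ := (hreal (w, y.1) y (y.2, w)).2 ⟨rfl, rfl⟩
    exact ⟨h, hh⟩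
  have hΓ : ∀ z, ∃ g : S, c g = Γ z := fun z => by
    obtain ⟨g, h, l, -, -, hl, -⟩ := (hreal (z.2, w) (w, z.1) z).2 ⟨rfl, Prod.ext rfl rfl⟩
    exact ⟨l, hl⟩
  choose α hα using hA
  choose β hβ using hB
  choose γ hγ using hΓ
  have htw : ∀ x y z : Fin n × Fin n,
      (∃ s : M₀ × M₀, α x * (s.1 : MulAut S) (β y) * (s.2 : MulAut S) (γ z) = 1) ↔
        (y.1 = x.2 ∧ z = (y.2, x.1)) := fun x y z =>
    (triangle_iff_twisted M₀ c hc (hα x) (hβ y) (hγ z)).symm.trans (hreal x y z)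
  have hpat : ∀ i j k : Fin n, ∃ s : M₀ × M₀,
      α (i, j) * (s.1 : MulAut S) (β (j, k)) * (s.2 : MulAut S) (γ (k, i)) = 1 :=
    fun i j k => (htw (i, j) (j, k) (k, i)).2 ⟨rfl, rfl⟩
  choose P hP using hpat
  -- the twisted realization over `Additive M₀` acting on `Additive S`
  let sm : Additive M₀ → Additive S →+ Additive S := fun g =>
    MonoidHom.toAdditive (((Additive.toMul g : M₀) : MulAut S).toMonoidHom)
  have hsm : ∀ g x, sm g x =
      Additive.ofMul (((Additive.toMul g : M₀) : MulAut S) (Additive.toMul x)) := fun g x => rfl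
  let R : TwistedRealization (Additive M₀) (Additive S) (Fin n) (Fin n) (Fin n) :=
    { sm := sm
      sm_add := fun g h x => by simp [sm, toMul_add]
      sm_zero := fun x => by simp [sm]
      a := fun i j => Additive.ofMul (α (i, j))
      b := fun j k => Additive.ofMul (β (j, k))
      d := fun k i => Additive.ofMul (γ (k, i))
      φ := fun i j k => Additive.ofMul (P i j k).1
      ψ := fun i j k => Additive.ofMul (P i j k).2
      eqn := fun i j k => by
        have h := hP i j k
        simp only [hsm, toMul_ofMul]
        rw [← ofMul_mul, ← ofMul_mul, h, ofMul_one]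
      real := fun i j k i' j' k' μ ν h => by
        simp only [hsm, toMul_ofMul] at h
        rw [← ofMul_mul, ← ofMul_mul, ofMul_eq_zero] at h
        obtain ⟨h1, h2⟩ := (htw (i, j) (j', k) (k', i')).1 ⟨(Additive.toMul μ, Additive.toMul ν), h⟩
        simp only [Prod.mk.injEq] at h1 h2
        exact ⟨h2.2, h1, h2.1⟩ }
  have hfpf' : ∀ g : Additive M₀, g ≠ 0 → ∀ x : Additive S, R.sm g x = x → x = 0 := by
    intro g hg x hx
    have hg' : (Additive.toMul g : M₀) ≠ 1 := fun h => hg (by simpa using congrArg Additive.ofMul h)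
    change sm g x = x at hx
    rw [hsm] at hx
    have h1 : ((Additive.toMul g : M₀) : MulAut S) (Additive.toMul x) = Additive.toMul x := by
      simpa using congrArg Additive.toMul hx
    have h2 := hfpf _ hg' _ h1
    simpa using congrArg Additive.ofMul h2
  have hmain := R.cube_le hfpf'
  have hcardS : Fintype.card (Additive S) = Fintype.card S := (Fintype.card_congr Additive.ofMul).symm
  have hcardM : Fintype.card (Additive M₀) = Nat.card M₀ := by
    rw [Fintype.card_eq_nat_card]; exact Nat.card_congr Additive.ofMul.symm
  rw [hcardS, hcardM] at hmain
  exact hmain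

open Summit.MatrixMultiplication.MatrixMultiplication.Theorems.TwistedSliceRank in
/-- **Rank form**: under the same hypotheses, `n³ ≤ 115200·|M₀|¹¹·#labels` (the rank of `𝒮(S, M₀)` is
the number of labels used, `≥ |S|/|M₀|`). Conj. 21 along abelian fixed-point-free translation schemes
needs `|M₀| ≥ (n/115200^{1/3})^{3/11}·(rank/n²)^{-1/11}`. [this work, Thm C2, rank corollary] -/
theorem translationScheme_fpf_realization_rank_bound (S : Type*) [CommGroup S] [Fintype S]
    (M₀ : Subgroup (MulAut S)) (hcomm : ∀ φ ψ : M₀, φ * ψ = ψ * φ)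
    (hfpf : ∀ φ : M₀, φ ≠ 1 → ∀ g : S, (φ : MulAut S) g = g → g = 1)
    {C : Type*} [Fintype C] (c : S → C) (hc : ∀ g h : S, c g = c h ↔ ∃ φ : M₀, (φ : MulAut S) g = h)
    {n : ℕ} (Acl Bcl Γ : Fin n × Fin n → C)
    (hreal : ∀ x y z : Fin n × Fin n,
      (∃ g h l : S, c g = Acl x ∧ c h = Bcl y ∧ c l = Γ z ∧ g * h * l = 1) ↔
        (y.1 = x.2 ∧ z = (y.2, x.1))) :
    n ^ 3 ≤ 115200 * Nat.card M₀ ^ 11 * Fintype.card C := by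
  classical
  haveI : Finite (MulAut S) :=
    Finite.of_injective (fun e : MulAut S => (e : S → S)) DFunLike.coe_injective
  haveI : Fintype M₀ := Fintype.ofFinite _
  have h1 := translationScheme_fpf_realization_cube_le S M₀ hcomm hfpf c hc Acl Bcl Γ hreal
  have h2 := card_le_card_labels_mul M₀ c hc
  rw [← Nat.card_eq_fintype_card (α := M₀)] at h2
  calc n ^ 3 ≤ 115200 * Nat.card M₀ ^ 10 * Fintype.card S := h1
    _ ≤ 115200 * Nat.card M₀ ^ 10 * (Fintype.card C * Nat.card M₀) := by gcongr
    _ = 115200 * Nat.card M₀ ^ 11 * Fintype.card C := by ring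

/-- **Triangles of a cyclotomic scheme = the twisted predicate** (the `𝔽_q`/`H ≤ 𝔽_qˣ` analogue of
`triangle_iff_twisted`). [CU13 Def. 11 for `Cyc(q,H)`, unfolded] -/
theorem cyclotomic_triangle_iff_twisted {F : Type*} [Field F] (H : Subgroup Fˣ) {Cl : Type*}
    (c : F → Cl) (hc : ∀ g h : F, c g = c h ↔ ∃ u ∈ H, (u : F) * g = h)
    {p q r : F} {i j k : Cl} (hp : c p = i) (hq : c q = j) (hr : c r = k) :
    (∃ g h l : F, c g = i ∧ c h = j ∧ c l = k ∧ g + h + l = 0) ↔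
      ∃ u ∈ H, ∃ v ∈ H, p + (u : F) * q + (v : F) * r = 0 := by
  constructor
  · rintro ⟨g, h, l, hg, hh, hl, hsum⟩
    obtain ⟨u₁, hu₁, e₁⟩ := (hc g p).1 (hg.trans hp.symm)
    obtain ⟨u₂, hu₂, e₂⟩ := (hc h q).1 (hh.trans hq.symm)
    obtain ⟨u₃, hu₃, e₃⟩ := (hc l r).1 (hl.trans hr.symm)
    refine ⟨u₁ * u₂⁻¹, H.mul_mem hu₁ (H.inv_mem hu₂), u₁ * u₃⁻¹, H.mul_mem hu₁ (H.inv_mem hu₃), ?_⟩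
    rw [← e₁, ← e₂, ← e₃, Units.val_mul, Units.val_mul, mul_assoc, mul_assoc,
      Units.inv_mul_cancel_left, Units.inv_mul_cancel_left, ← mul_add, ← mul_add, hsum, mul_zero]
  · rintro ⟨u, hu, v, hv, hs⟩
    refine ⟨p, (u : F) * q, (v : F) * r, hp, ?_, ?_, hs⟩
    · rw [← hq]; exact ((hc q _).2 ⟨u, hu, rfl⟩).symm
    · rw [← hr]; exact ((hc r _).2 ⟨v, hv, rfl⟩).symm

/-- **Theorem C2 for cyclotomic schemes.** If `Cyc(q, H)` (`H ≤ 𝔽_qˣ`, classes = `H`-orbits of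
`y - x`) realizes `⟨n,n,n⟩` (CU13 Def. 12), then `n³ ≤ 115200·|H|¹⁰·q`. With
`Cyclotomic.cyclotomicScheme_realization_bound` this refutes Conj. 21 on all cyclotomic schemes.
[this work, Thm C2 / Cor. C′] -/
theorem cyclotomicScheme_realization_cube_le {F : Type*} [Field F] [Fintype F] (H : Subgroup Fˣ)
    {Cl : Type*} (c : F → Cl) (hc : ∀ g h : F, c g = c h ↔ ∃ u ∈ H, (u : F) * g = h)
    {n : ℕ} (α β γ : Fin n × Fin n → Cl)
    (hreal : ∀ x y z : Fin n × Fin n,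
      (∃ g h l : F, c g = α x ∧ c h = β y ∧ c l = γ z ∧ g + h + l = 0) ↔
        (y.1 = x.2 ∧ z = (y.2, x.1))) :
    n ^ 3 ≤ 115200 * Nat.card H ^ 10 * Fintype.card F := by
  classical
  rcases Nat.eq_zero_or_pos n with rfl | hn
  · simp
  haveI : Fintype H := Fintype.ofFinite _
  -- representatives
  have w : Fin n := ⟨0, hn⟩
  have hA : ∀ x, ∃ g : F, c g = α x := fun x => by
    obtain ⟨g, h, l, hg, -, -, -⟩ := (hreal x (x.2, w) (w, x.1)).2 ⟨rfl, rfl⟩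
    exact ⟨g, hg⟩
  have hB : ∀ y, ∃ g : F, c g = β y := fun y => by
    obtain ⟨g, h, l, -, hh, -, -⟩ := (hreal (w, y.1) y (y.2, w)).2 ⟨rfl, rfl⟩
    exact ⟨h, hh⟩
  have hΓ : ∀ z, ∃ g : F, c g = γ z := fun z => by
    obtain ⟨g, h, l, -, -, hl, -⟩ := (hreal (z.2, w) (w, z.1) z).2 ⟨rfl, Prod.ext rfl rfl⟩
    exact ⟨l, hl⟩
  choose a ha using hA
  choose b hb using hB
  choose d hd using hΓ
  have htw : ∀ x y z : Fin n × Fin n,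
      (∃ u ∈ H, ∃ v ∈ H, a x + (u : F) * b y + (v : F) * d z = 0) ↔ (y.1 = x.2 ∧ z = (y.2, x.1)) :=
    fun x y z => (cyclotomic_triangle_iff_twisted H c hc (ha x) (hb y) (hd z)).symm.trans (hreal x y z)
  have hpat : ∀ i j k : Fin n, ∃ u ∈ H, ∃ v ∈ H,
      a (i, j) + (u : F) * b (j, k) + (v : F) * d (k, i) = 0 :=
    fun i j k => (htw (i, j) (j, k) (k, i)).2 ⟨rfl, rfl⟩
  choose U hU V hV hE using hpat
  -- the twisted realization over `Additive H` acting on `F` by multiplication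
  let sm : Additive H → F →+ F := fun g => AddMonoidHom.mulLeft (((Additive.toMul g : H) : Fˣ) : F)
  have hsm : ∀ g x, sm g x = (((Additive.toMul g : H) : Fˣ) : F) * x := fun g x => rfl
  let R : TwistedRealization (Additive H) F (Fin n) (Fin n) (Fin n) :=
    { sm := sm
      sm_add := fun g h x => by simp [sm, toMul_add, mul_assoc]
      sm_zero := fun x => by simp [sm]
      a := fun i j => a (i, j)
      b := fun j k => b (j, k)
      d := fun k i => d (k, i)
      φ := fun i j k => Additive.ofMul ⟨U i j k, hU i j k⟩
      ψ := fun i j k => Additive.ofMul ⟨V i j k, hV i j k⟩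
      eqn := fun i j k => by
        simp only [hsm, toMul_ofMul]
        exact hE i j k
      real := fun i j k i' j' k' μ ν h => by
        simp only [hsm] at h
        obtain ⟨h1, h2⟩ := (htw (i, j) (j', k) (k', i')).1
          ⟨_, (Additive.toMul μ).2, _, (Additive.toMul ν).2, h⟩
        simp only [Prod.mk.injEq] at h1 h2
        exact ⟨h2.2, h1, h2.1⟩ }
  have hfpf' : ∀ g : Additive H, g ≠ 0 → ∀ x : F, R.sm g x = x → x = 0 := by
    intro g hg x hx
    change sm g x = x at hx
    rw [hsm] at hx
    have hg' : (((Additive.toMul g : H) : Fˣ) : F) ≠ 1 := by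
      intro h1
      apply hg
      have h2 : (Additive.toMul g : H) = 1 := by
        apply Subtype.ext; apply Units.ext; simpa using h1
      simpa using congrArg Additive.ofMul h2
    have h3 : ((((Additive.toMul g : H) : Fˣ) : F) - 1) * x = 0 := by rw [sub_mul, one_mul, hx, sub_self]
    rcases mul_eq_zero.1 h3 with h4 | h4
    · exact absurd (sub_eq_zero.1 h4) hg'
    · exact h4
  have hmain := R.cube_le hfpf'
  have hcardM : Fintype.card (Additive H) = Nat.card H := by
    rw [Fintype.card_eq_nat_card]; exact Nat.card_congr Additive.ofMul.symm
  rw [hcardM] at hmain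
  exact hmain

end Summit.MatrixMultiplication.MatrixMultiplication.Theorems.TwistedTPP
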